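import Summits.QuantumFields.YangMills.Theorems.ColdStartUniversalityLatticeLangevinLiebRobinsonCorrelationLightConeWilsonLoops
import Summits.QuantumFields.YangMills.Theorems.ColdStartUniversalityLatticeLangevinLiebRobinsonThreePointClustering
import HarnessLib

/-!
# Route `ColdStartUniversality` (fixed-cut-off SZZ dynamics; LIEB–ROBINSON / LOCALITY package, file 37):
# ★★★ WILSON LOOPS FROM THE COLD START ARE NEVER CORRELATED BEYOND `e^(−c(R+1))` — uniform in time and volume (`|β'| < 1/12`)

Helper file (seat `ym-line-csu-p1`, g32; `--supports stmt-QuantumFields-24809`).  Quotable forms of the uniform-in-time dynamic clustering from a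
deterministic start (file 36, `transition_covariance_abs_le_uniform_of_separated`) for the `SU(2)` lattice Langevin dynamics of Shen–Zhu–Zhu on
`(ℤ/L)³` in the strong-coupling window `|β'| < 1/12`:
* ★★★ `solution_covariance_abs_le_uniform_of_separated` — the same bound along every strong solution from a deterministic start on any filtered
  probability space (in particular the COLD START `U_0 ≡ 1` of the route);
* `uniform_bound_le_of_words` (real bookkeeping: the bound is increasing in `Σℓ^F`, `Σℓ^G`, `Amp`; for words these are `≤ 2π|w₁|²`, `2π|w₂|²`,
  `10π(|w₁|+|w₂|)³`);
* ★★★ `wilson_loop_transition_covariance_abs_le_uniform`, `wilson_loop_solution_covariance_abs_le_uniform` — for loop words `w₁, w₂` whose links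
  have base sites at cyclic sup-distance `≥ R+1`, EVERY start / every cold-start solution, EVERY time `t`:
  `|E[Re tr w₁(U_t)·Re tr w₂(U_t)] − E[Re tr w₁(U_t)]·E[Re tr w₂(U_t)]| ≤ π²(384t⋆|w₁|²|w₂|² + 32|w₁|²|w₂|²(1+T_R) + 120(27(1+6(λ+ρ)/ρ)³+2)(|w₁|+|w₂|)³)·e^(−ρt⋆/2)`,
  `t⋆ = (R+1) log 2/(2λ+ρ)`, `T_R = (R+1) log 108/(λ+ρ)`, `ρ = 1 − 12|β'|`, `λ = (1300+4√2)|β'|` — NO volume factor, NO time dependence,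
  exponential decay in the separation: along the cold-start evolution at strong coupling two distant Wilson loops are uncorrelated AT ALL TIMES.
THEOREMS ONLY, no definition, no sorry; [folklore].  HONEST FRAMING: fixed cut-off, fixed window `|β'| < 1/12` (left by the route's scaling
`β'_K = (γε_K)⁻¹/2 → ∞`); nothing `K`-uniform; `UniformColdStartMixing` (24809) is NOT restated; no crux, rung or summit statement is proved; the
Yang–Mills mass gap is NOT proved.
-/

set_option autoImplicit false

noncomputable section

namespace Summit.QuantumFields.YangMills.Theorems.ColdStartUniversality.LiebRobinson

open MeasureTheory ProbabilityTheory Matrix Complex Finset Filter Set Metric intervalIntegral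
open scoped ComplexConjugate BigOperators Matrix NNReal ENNReal Topology
open Literature.Probability.Process Literature.MathematicalPhysics.QuantumFieldTheory
open Literature.MathematicalPhysics.QuantumFieldTheory.Balaban1983to89
open Literature.MathematicalPhysics.QuantumLattice (fundamentalRep fundamentalLatticeRep continuous_fundamentalRep fundamentalRep_apply)

variable {L : ℕ} [NeZero L]

/-! ## Along solutions; Wilson loops uniformly in time -/

/-- ★★★ **Uniform-in-time dynamic clustering ALONG EVERY SZZ SOLUTION from a deterministic start** (`|β'| < 1/12`; any filtered probability
space, any flat Brownian driver; in particular the COLD START): with the notation of `transition_covariance_abs_le_uniform_of_separated`,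
`|E[F(U_t)G(U_t)] − E[F(U_t)]E[G(U_t)]|` obeys the same time-independent, volume-free bound, exponentially small in the separation `R`.
Fixed cut-off; `UniformColdStartMixing` (24809) is NOT restated; the Yang–Mills mass gap is NOT proved. [folklore] -/
theorem solution_covariance_abs_le_uniform_of_separated (L : ℕ) [NeZero L] (β' : ℝ) (hβ : |β'| < 1 / 12) (t : ℝ≥0)
    (x₀ : (GaugeConfig 3 L (Matrix.specialUnitaryGroup (Fin 2) ℂ)))
    (Ω : Type) [MeasurableSpace Ω] (P : Measure Ω) [IsProbabilityMeasure P]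
    (W : ℝ≥0 → Ω → (Edge 3 L × NoiseIdx 2 → ℝ)) (hW : IsFlatBrownian W P)
    (U : ℝ≥0 → Ω → (GaugeConfig 3 L (Matrix.specialUnitaryGroup (Fin 2) ℂ))) (hU0 : ∀ ω, U 0 ω = x₀)
    (hU : (latticeLangevinDynamics (fundamentalLatticeRep 2) β').IsSolution (fundamentalRep (Fin 2)) hW.natFiltration P W U)
    {f : (Edge 3 L × Fin 2 × Fin 2 × Bool → ℝ) → ℝ} (hf : ContDiff ℝ 5 f) {ℓF : Edge 3 L → ℝ} (hℓF : ∀ e, 0 ≤ ℓF e) {MF : ℝ}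
    {g : (Edge 3 L × Fin 2 × Fin 2 × Bool → ℝ) → ℝ} (hg : ContDiff ℝ 5 g) {ℓG : Edge 3 L → ℝ} (hℓG : ∀ e, 0 ≤ ℓG e) {MG : ℝ}
    (Λf Λg : Finset (Edge 3 L)) (hΛf : ∀ e, e ∉ Λf → ℓF e = 0) (hΛg : ∀ e, e ∉ Λg → ℓG e = 0) (R : ℕ)
    (hsep : ∀ e' ∈ Λf, ∀ e ∈ Λg, R + 1 ≤ (Finset.univ.sup fun i : Fin 3 => ((e'.1 i - e.1 i).valMinAbs).natAbs)) :
    let coords : GaugeConfig 3 L (Matrix.specialUnitaryGroup (Fin 2) ℂ) → (Edge 3 L × Fin 2 × Fin 2 × Bool → ℝ) :=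
      fun V q => (fun z : ℂ => if q.2.2.2 then z.im else z.re)
        ((fundamentalRep (Fin 2) (V q.1) : Matrix (Fin 2) (Fin 2) ℂ) q.2.1 q.2.2.1)
    (∀ y, |f (coords y)| ≤ MF) → (∀ y, |g (coords y)| ≤ MG) →
    (∀ (e : Edge 3 L) (y y' : (GaugeConfig 3 L (Matrix.specialUnitaryGroup (Fin 2) ℂ))), (∀ f', f' ≠ e → y f' = y' f') →
      |f (coords y) - f (coords y')| ≤ ℓF e * frobNorm ((y e : Matrix (Fin 2) (Fin 2) ℂ) - (y' e : Matrix (Fin 2) (Fin 2) ℂ))) →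
    (∀ (e : Edge 3 L) (y y' : (GaugeConfig 3 L (Matrix.specialUnitaryGroup (Fin 2) ℂ))), (∀ f', f' ≠ e → y f' = y' f') →
      |g (coords y) - g (coords y')| ≤ ℓG e * frobNorm ((y e : Matrix (Fin 2) (Fin 2) ℂ) - (y' e : Matrix (Fin 2) (Fin 2) ℂ))) →
    |(∫ ω, f (coords (U t ω)) * g (coords (U t ω)) ∂P) - (∫ ω, f (coords (U t ω)) ∂P) * (∫ ω, g (coords (U t ω)) ∂P)| ≤
      (96 * (((R : ℝ) + 1) * Real.log 2 / (2 * ((1300 + 4 * Real.sqrt 2) * |β'|) + (1 - 12 * |β'|))) * (∑ e : Edge 3 L, ℓF e) * (∑ e : Edge 3 L, ℓG e) + 8 * (∑ e : Edge 3 L, ℓF e) * (∑ e : Edge 3 L, ℓG e) * (1 + (((R : ℝ) + 1) * Real.log 108 / (((1300 + 4 * Real.sqrt 2) * |β'|) + (1 - 12 * |β'|)))) + 12 * Real.pi * (27 * (1 + 6 * (((1300 + 4 * Real.sqrt 2) * |β'|) + (1 - 12 * |β'|)) / (1 - 12 * |β'|)) ^ 3 + 2) * (((Λf ∪ Λg).card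 : ℝ) * Real.sqrt (∑ e : Edge 3 L, (MF * ℓG e + MG * ℓF e) ^ 2) + MG * (Λf.card : ℝ) * Real.sqrt (∑ e : Edge 3 L, ℓF e ^ 2) + MF * (Λg.card : ℝ) * Real.sqrt (∑ e : Edge 3 L, ℓG e ^ 2))) * Real.exp (-((1 - 12 * |β'|) * (((R : ℝ) + 1) * Real.log 2 / (2 * (2 * ((1300 + 4 * Real.sqrt 2) * |β'|) + (1 - 12 * |β'|)))))) := by
  intro coords hMF hMG hLf hLg
  classical
  haveI := secondCountableTopology_su2
  haveI := borelSpace_config L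
  obtain ⟨κ, hκ, -, hreal⟩ := exists_transitionKernel L β'
  haveI := hκ
  have h := transition_covariance_abs_le_uniform_of_separated L β' hβ κ hreal hf hℓF hg hℓG Λf Λg hΛf hΛg R hsep t x₀ hMF hMG hLf hLg
  have hlaw : κ t x₀ = P.map (U t) := hreal t x₀ Ω P W hW U hU0 hU
  have hmU : Measurable (U t) := (hU.adapted t).mono (hW.natFiltration.le t) le_rfl
  have hco : Continuous coords := continuous_coords (L := L)
  have hFm : Measurable fun y : (GaugeConfig 3 L (Matrix.specialUnitaryGroup (Fin 2) ℂ)) => f (coords y) :=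
    (hf.continuous.comp hco).measurable
  have hGm : Measurable fun y : (GaugeConfig 3 L (Matrix.specialUnitaryGroup (Fin 2) ℂ)) => g (coords y) :=
    (hg.continuous.comp hco).measurable
  have hFGm : Measurable fun y : (GaugeConfig 3 L (Matrix.specialUnitaryGroup (Fin 2) ℂ)) => f (coords y) * g (coords y) := hFm.mul hGm
  have e1 : ∫ y, f (coords y) * g (coords y) ∂(κ t x₀) = ∫ ω, f (coords (U t ω)) * g (coords (U t ω)) ∂P := by
    rw [hlaw, integral_map hmU.aemeasurable hFGm.aestronglyMeasurable]
  have e2 : ∫ y, f (coords y) ∂(κ t x₀) = ∫ ω, f (coords (U t ω)) ∂P := by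
    rw [hlaw, integral_map hmU.aemeasurable hFm.aestronglyMeasurable]
  have e3 : ∫ y, g (coords y) ∂(κ t x₀) = ∫ ω, g (coords (U t ω)) ∂P := by
    rw [hlaw, integral_map hmU.aemeasurable hGm.aestronglyMeasurable]
  rw [← e1, ← e2, ← e3]
  exact h

/-- **Monotone bookkeeping for loop words** (pure real arithmetic): the uniform bound is increasing in the profile sums and the amplitude, and
for words these are at most `2π|w₁|²`, `2π|w₂|²`, `10π(|w₁|+|w₂|)³`. [folklore] -/
theorem uniform_bound_le_of_words {lam rho SF SG Amp n₁ n₂ : ℝ} (hlam0 : 0 ≤ lam) (hrho0 : 0 < rho) (R : ℕ)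
    (hSG0 : 0 ≤ SG) (hSF : SF ≤ 2 * Real.pi * n₁ ^ 2) (hSG : SG ≤ 2 * Real.pi * n₂ ^ 2) (hAmp : Amp ≤ 10 * Real.pi * (n₁ + n₂) ^ 3) :
    (96 * (((R : ℝ) + 1) * Real.log 2 / (2 * lam + rho)) * SF * SG + 8 * SF * SG * (1 + (((R : ℝ) + 1) * Real.log 108 / (lam + rho))) + 12 * Real.pi * (27 * (1 + 6 * (lam + rho) / rho) ^ 3 + 2) * Amp) * Real.exp (-(rho * (((R : ℝ) + 1) * Real.log 2 / (2 * (2 * lam + rho))))) ≤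
      Real.pi ^ 2 * (384 * (((R : ℝ) + 1) * Real.log 2 / (2 * lam + rho)) * n₁ ^ 2 * n₂ ^ 2 + 32 * n₁ ^ 2 * n₂ ^ 2 * (1 + (((R : ℝ) + 1) * Real.log 108 / (lam + rho))) + 120 * (27 * (1 + 6 * (lam + rho) / rho) ^ 3 + 2) * (n₁ + n₂) ^ 3) * Real.exp (-(rho * (((R : ℝ) + 1) * Real.log 2 / (2 * (2 * lam + rho))))) := by
  obtain ⟨TR, hTR⟩ : ∃ TR : ℝ, TR = (((R : ℝ) + 1) * Real.log 108 / (lam + rho)) := ⟨_, rfl⟩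
  obtain ⟨ts, hts⟩ : ∃ ts : ℝ, ts = (((R : ℝ) + 1) * Real.log 2 / (2 * lam + rho)) := ⟨_, rfl⟩
  obtain ⟨E, hE⟩ : ∃ E : ℝ, E = Real.exp (-(rho * (((R : ℝ) + 1) * Real.log 2 / (2 * (2 * lam + rho))))) := ⟨_, rfl⟩
  obtain ⟨K3, hK3⟩ : ∃ K3 : ℝ, K3 = (27 * (1 + 6 * (lam + rho) / rho) ^ 3 + 2) := ⟨_, rfl⟩
  rw [← hTR, ← hts, ← hE, ← hK3]
  have hden1 : 0 < lam + rho := by linarith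
  have hden2 : 0 < 2 * lam + rho := by linarith
  have hts0 : 0 ≤ ts := by rw [hts]; positivity
  have hTR0 : 0 ≤ TR := by rw [hTR]; positivity
  have hE0 : 0 ≤ E := by rw [hE]; exact (Real.exp_pos _).le
  have hK30 : 0 ≤ K3 := by rw [hK3]; positivity
  have hpi : 0 ≤ Real.pi := Real.pi_pos.le
  clear hTR hts hE hK3
  have hprod : SF * SG ≤ (2 * Real.pi * n₁ ^ 2) * (2 * Real.pi * n₂ ^ 2) := mul_le_mul hSF hSG hSG0 (by positivity)
  have h1 : 96 * ts * SF * SG ≤ 96 * ts * ((2 * Real.pi * n₁ ^ 2) * (2 * Real.pi * n₂ ^ 2)) := by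
    rw [mul_assoc (96 * ts)]; exact mul_le_mul_of_nonneg_left hprod (by positivity)
  have h2 : 8 * SF * SG * (1 + TR) ≤ 8 * ((2 * Real.pi * n₁ ^ 2) * (2 * Real.pi * n₂ ^ 2)) * (1 + TR) := by
    rw [mul_assoc (8 : ℝ)]; exact mul_le_mul_of_nonneg_right (mul_le_mul_of_nonneg_left hprod (by norm_num)) (by linarith)
  have h3 : 12 * Real.pi * K3 * Amp ≤ 12 * Real.pi * K3 * (10 * Real.pi * (n₁ + n₂) ^ 3) := mul_le_mul_of_nonneg_left hAmp (by positivity)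
  have hsum := add_le_add (add_le_add h1 h2) h3
  have hfin := mul_le_mul_of_nonneg_right hsum hE0
  refine hfin.trans (le_of_eq ?_)
  ring

/-- ★★★ **WILSON LOOPS FROM THE COLD START ARE NEVER CORRELATED BEYOND `e^(−c(R+1))`** (`|β'| < 1/12`, EVERY volume, EVERY time).  For two loop
words `w₁, w₂` whose links have base sites at cyclic sup-distance `≥ R+1`, every realising kernel family, every `t ≥ 0` and every start `x`:
`|κ_t(Re tr w₁·Re tr w₂)(x) − κ_t(Re tr w₁)(x)·κ_t(Re tr w₂)(x)| ≤ π²(384t⋆|w₁|²|w₂|² + 32|w₁|²|w₂|²(1+T_R) + 120(27(1+6(λ+ρ)/ρ)³+2)(|w₁|+|w₂|)³)·e^(−ρt⋆/2)`,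
`t⋆ = (R+1) log 2/(2λ+ρ)`, `T_R = (R+1) log 108/(λ+ρ)`, `ρ = 1 − 12|β'|`, `λ = (1300+4√2)|β'|` (`transition_covariance_abs_le_uniform_of_separated` with
the word data: `|Re tr w| ≤ 2`, profile `2π|w|` on the `≤ |w|` links of `w`).  Fixed cut-off; the Yang–Mills mass gap is NOT proved. [folklore] -/
theorem wilson_loop_transition_covariance_abs_le_uniform (L : ℕ) [NeZero L] (β' : ℝ) (hβ : |β'| < 1 / 12)
    (κ : ℝ≥0 → Kernel (GaugeConfig 3 L (Matrix.specialUnitaryGroup (Fin 2) ℂ))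
      (GaugeConfig 3 L (Matrix.specialUnitaryGroup (Fin 2) ℂ))) [∀ t, IsMarkovKernel (κ t)]
    (hreal : ∀ (t : ℝ≥0) (x : GaugeConfig 3 L (Matrix.specialUnitaryGroup (Fin 2) ℂ))
        (Ω : Type) [MeasurableSpace Ω] (P : Measure Ω) [IsProbabilityMeasure P]
        (W : ℝ≥0 → Ω → (Edge 3 L × NoiseIdx 2 → ℝ)) (hW : IsFlatBrownian W P)
        (U : ℝ≥0 → Ω → GaugeConfig 3 L (Matrix.specialUnitaryGroup (Fin 2) ℂ)),
        (∀ ω, U 0 ω = x) →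
        (latticeLangevinDynamics (fundamentalLatticeRep 2) β').IsSolution (fundamentalRep (Fin 2))
          hW.natFiltration P W U →
        κ t x = P.map (U t))
    (l₁ l₂ : List (Edge 3 L × Bool)) (R : ℕ)
    (hsep : ∀ e' ∈ (l₁.map Prod.fst).toFinset, ∀ e ∈ (l₂.map Prod.fst).toFinset, R + 1 ≤ (Finset.univ.sup fun i : Fin 3 => ((e'.1 i - e.1 i).valMinAbs).natAbs))
    (t : ℝ≥0) (x : (GaugeConfig 3 L (Matrix.specialUnitaryGroup (Fin 2) ℂ))) :
    let coords : GaugeConfig 3 L (Matrix.specialUnitaryGroup (Fin 2) ℂ) → (Edge 3 L × Fin 2 × Fin 2 × Bool → ℝ) :=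
      fun V q => (fun z : ℂ => if q.2.2.2 then z.im else z.re)
        ((fundamentalRep (Fin 2) (V q.1) : Matrix (Fin 2) (Fin 2) ℂ) q.2.1 q.2.2.1)
    |(∫ y, (fun y : (Edge 3 L × Fin 2 × Fin 2 × Bool → ℝ) => ((l₁.map (fun a : Edge 3 L × Bool => if a.2 then ((fun (ee : Edge 3 L) => Matrix.of fun (i j : Fin 2) => ((y (ee, i, j, false) : ℝ) : ℂ) + ((y (ee, i, j, true) : ℝ) : ℂ) * Complex.I) a.1)ᴴ else (fun (ee : Edge 3 L) => Matrix.of fun (i j : Fin 2) => ((y (ee, i, j, false) : ℝ) : ℂ) + ((y (ee, i, j, true) : ℝ) : ℂ) * Complex.I) a.1)).prod).trace.re) (coords y) * (fun y : (Edge 3 L × Fin 2 × Fin 2 × Bool → ℝ) => ((l₂.map (fun a : Edge 3 L × Bool => if a.2 then ((fun (ee : Edge 3 L) => Matrix.of fun (i j : Fin 2) => ((y (ee, i, j, false) : ℝ) : ℂ) + ((y (ee, i, j, true) : ℝ) : ℂ) * Complex.I) a.1)ᴴ else (fun (ee : Edge 3 L) => Matrix.of fun (i j : Fin 2) => ((y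 (ee, i, j, false) : ℝ) : ℂ) + ((y (ee, i, j, true) : ℝ) : ℂ) * Complex.I) a.1)).prod).trace.re) (coords y) ∂(κ t x)) -
        (∫ y, (fun y : (Edge 3 L × Fin 2 × Fin 2 × Bool → ℝ) => ((l₁.map (fun a : Edge 3 L × Bool => if a.2 then ((fun (ee : Edge 3 L) => Matrix.of fun (i j : Fin 2) => ((y (ee, i, j, false) : ℝ) : ℂ) + ((y (ee, i, j, true) : ℝ) : ℂ) * Complex.I) a.1)ᴴ else (fun (ee : Edge 3 L) => Matrix.of fun (i j : Fin 2) => ((y (ee, i, j, false) : ℝ) : ℂ) + ((y (ee, i, j, true) : ℝ) : ℂ) * Complex.I) a.1)).prod).trace.re) (coords y) ∂(κ t x)) * (∫ y, (fun y : (Edge 3 L × Fin 2 × Fin 2 × Bool → ℝ) => ((l₂.map (fun a : Edge 3 L × Bool => if a.2 then ((fun (ee : Edge 3 L) => Matrix.of fun (i j : Fin 2) => ((y (ee, i, j, false) : ℝ) : ℂ) + ((y (ee, i, j, true) : ℝ) : ℂ) * Complex.I) a.1)ᴴ else (fun (ee : Edge 3 L) => Matrix.of fun (i j : Fin 2) =>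 ((y (ee, i, j, false) : ℝ) : ℂ) + ((y (ee, i, j, true) : ℝ) : ℂ) * Complex.I) a.1)).prod).trace.re) (coords y) ∂(κ t x))| ≤
      Real.pi ^ 2 * (384 * (((R : ℝ) + 1) * Real.log 2 / (2 * ((1300 + 4 * Real.sqrt 2) * |β'|) + (1 - 12 * |β'|))) * (l₁.length : ℝ) ^ 2 * (l₂.length : ℝ) ^ 2 + 32 * (l₁.length : ℝ) ^ 2 * (l₂.length : ℝ) ^ 2 * (1 + (((R : ℝ) + 1) * Real.log 108 / (((1300 + 4 * Real.sqrt 2) * |β'|) + (1 - 12 * |β'|)))) + 120 * (27 * (1 + 6 * (((1300 + 4 * Real.sqrt 2) * |β'|) + (1 - 12 * |β'|)) / (1 - 12 * |β'|)) ^ 3 + 2) * ((l₁.length : ℝ) + (l₂.length : ℝ)) ^ 3) * Real.exp (-((1 - 12 * |β'|) * (((R : ℝ) + 1) * Real.log 2 / (2 * (2 * ((1300 + 4 * Real.sqrt 2) * |β'|) + (1 - 12 * |β'|)))))) := by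
  intro coords
  classical
  set n₁ : ℝ := (l₁.length : ℝ) with hn₁
  set n₂ : ℝ := (l₂.length : ℝ) with hn₂
  set ℓF : Edge 3 L → ℝ := fun e => if e ∈ (l₁.map Prod.fst).toFinset then 2 * Real.pi * n₁ else 0 with hℓF
  set ℓG : Edge 3 L → ℝ := fun e => if e ∈ (l₂.map Prod.fst).toFinset then 2 * Real.pi * n₂ else 0 with hℓG
  have hpi : 0 ≤ Real.pi := Real.pi_pos.le
  have hn₁0 : 0 ≤ n₁ := by positivity
  have hn₂0 : 0 ≤ n₂ := by positivity
  have hℓF0 : ∀ e, 0 ≤ ℓF e := fun e => by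
    simp only [hℓF]; split_ifs
    · positivity
    · exact le_rfl
  have hℓG0 : ∀ e, 0 ≤ ℓG e := fun e => by
    simp only [hℓG]; split_ifs
    · positivity
    · exact le_rfl
  have hΛF : ∀ e, e ∉ (l₁.map Prod.fst).toFinset → ℓF e = 0 := fun e he => by simp only [hℓF, he, if_false]
  have hΛG : ∀ e, e ∉ (l₂.map Prod.fst).toFinset → ℓG e = 0 := fun e he => by simp only [hℓG, he, if_false]
  have hLf := word_linkLipschitz_profile L β' l₁
  have hLg := word_linkLipschitz_profile L β' l₂
  have hBf := fun y : (GaugeConfig 3 L (Matrix.specialUnitaryGroup (Fin 2) ℂ)) => abs_word_le_two (L := L) l₁ y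
  have hBg := fun y : (GaugeConfig 3 L (Matrix.specialUnitaryGroup (Fin 2) ℂ)) => abs_word_le_two (L := L) l₂ y
  have key := transition_covariance_abs_le_uniform_of_separated L β' hβ κ hreal (contDiff_word (L := L) l₁ (m := 5)) hℓF0
    (contDiff_word (L := L) l₂ (m := 5)) hℓG0 (l₁.map Prod.fst).toFinset (l₂.map Prod.fst).toFinset hΛF hΛG R hsep t x
    (fun y => hBf y) (fun y => hBg y) (fun e y y' h => hLf e y y' h) (fun e y y' h => hLg e y y' h)
  refine key.trans ?_
  -- the word data: `#Λ ≤ |w|`, `Σℓ ≤ 2π|w|²`, `Σℓ² ≤ (2π|w|²)²`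
  have hcard : ∀ (l : List (Edge 3 L × Bool)), (((l.map Prod.fst).toFinset.card : ℕ) : ℝ) ≤ (l.length : ℝ) := by
    intro l
    have h1 := List.toFinset_card_le (l.map Prod.fst)
    rw [List.length_map] at h1
    exact_mod_cast h1
  have hsq_nat : ∀ (l : List (Edge 3 L × Bool)), (l.length : ℝ) ≤ (l.length : ℝ) ^ 2 := by
    intro l
    rcases Nat.eq_zero_or_pos l.length with h0 | hpos
    · rw [h0]; norm_num
    · have h1 : (1 : ℝ) ≤ (l.length : ℝ) := by exact_mod_cast hpos
      nlinarith
  have hsum : ∀ (l : List (Edge 3 L × Bool)) (c : ℝ), 0 ≤ c →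
      (∑ e : Edge 3 L, (if e ∈ (l.map Prod.fst).toFinset then c else 0)) ≤ (l.length : ℝ) * c := by
    intro l c hc
    rw [Finset.sum_ite_mem, Finset.univ_inter, Finset.sum_const, nsmul_eq_mul]
    exact mul_le_mul_of_nonneg_right (hcard l) hc
  have hsumsq : ∀ (l : List (Edge 3 L × Bool)) (c : ℝ), 0 ≤ c →
      (∑ e : Edge 3 L, (if e ∈ (l.map Prod.fst).toFinset then c else 0) ^ 2) ≤ (l.length : ℝ) * c ^ 2 := by
    intro l c hc
    have e : ∀ e : Edge 3 L, (if e ∈ (l.map Prod.fst).toFinset then c else 0) ^ 2 = (if e ∈ (l.map Prod.fst).toFinset then c ^ 2 else 0) := by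
      intro e; split_ifs <;> simp
    simp_rw [e]
    exact hsum l (c ^ 2) (by positivity)
  have hSF : (∑ e : Edge 3 L, ℓF e) ≤ 2 * Real.pi * n₁ ^ 2 := by
    calc (∑ e : Edge 3 L, ℓF e) ≤ n₁ * (2 * Real.pi * n₁) := hsum l₁ _ (by positivity)
      _ = 2 * Real.pi * n₁ ^ 2 := by ring
  have hSG : (∑ e : Edge 3 L, ℓG e) ≤ 2 * Real.pi * n₂ ^ 2 := by
    calc (∑ e : Edge 3 L, ℓG e) ≤ n₂ * (2 * Real.pi * n₂) := hsum l₂ _ (by positivity)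
      _ = 2 * Real.pi * n₂ ^ 2 := by ring
  have hSF2 : (∑ e : Edge 3 L, ℓF e ^ 2) ≤ (2 * Real.pi * n₁ ^ 2) ^ 2 := by
    calc (∑ e : Edge 3 L, ℓF e ^ 2) ≤ n₁ * (2 * Real.pi * n₁) ^ 2 := hsumsq l₁ _ (by positivity)
      _ ≤ n₁ ^ 2 * (2 * Real.pi * n₁) ^ 2 := mul_le_mul_of_nonneg_right (hsq_nat l₁) (by positivity)
      _ = (2 * Real.pi * n₁ ^ 2) ^ 2 := by ring
  have hSG2 : (∑ e : Edge 3 L, ℓG e ^ 2) ≤ (2 * Real.pi * n₂ ^ 2) ^ 2 := by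
    calc (∑ e : Edge 3 L, ℓG e ^ 2) ≤ n₂ * (2 * Real.pi * n₂) ^ 2 := hsumsq l₂ _ (by positivity)
      _ ≤ n₂ ^ 2 * (2 * Real.pi * n₂) ^ 2 := mul_le_mul_of_nonneg_right (hsq_nat l₂) (by positivity)
      _ = (2 * Real.pi * n₂ ^ 2) ^ 2 := by ring
  have hrootF : Real.sqrt (∑ e : Edge 3 L, ℓF e ^ 2) ≤ 2 * Real.pi * n₁ ^ 2 := by
    rw [← Real.sqrt_sq (show (0:ℝ) ≤ 2 * Real.pi * n₁ ^ 2 by positivity)]; exact Real.sqrt_le_sqrt hSF2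
  have hrootG : Real.sqrt (∑ e : Edge 3 L, ℓG e ^ 2) ≤ 2 * Real.pi * n₂ ^ 2 := by
    rw [← Real.sqrt_sq (show (0:ℝ) ≤ 2 * Real.pi * n₂ ^ 2 by positivity)]; exact Real.sqrt_le_sqrt hSG2
  have hmix : (∑ e : Edge 3 L, (2 * ℓG e + 2 * ℓF e) ^ 2) ≤ (6 * Real.pi * (n₁ ^ 2 + n₂ ^ 2)) ^ 2 := by
    have hpt : ∀ e : Edge 3 L, (2 * ℓG e + 2 * ℓF e) ^ 2 ≤ 8 * ℓG e ^ 2 + 8 * ℓF e ^ 2 := fun e => by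
      nlinarith [sq_nonneg (ℓG e - ℓF e)]
    calc (∑ e : Edge 3 L, (2 * ℓG e + 2 * ℓF e) ^ 2) ≤ ∑ e : Edge 3 L, (8 * ℓG e ^ 2 + 8 * ℓF e ^ 2) := Finset.sum_le_sum fun e _ => hpt e
      _ = 8 * (∑ e : Edge 3 L, ℓG e ^ 2) + 8 * (∑ e : Edge 3 L, ℓF e ^ 2) := by rw [Finset.sum_add_distrib, Finset.mul_sum, Finset.mul_sum]
      _ ≤ 8 * (2 * Real.pi * n₂ ^ 2) ^ 2 + 8 * (2 * Real.pi * n₁ ^ 2) ^ 2 := by linarith [hSF2, hSG2]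
      _ ≤ (6 * Real.pi * (n₁ ^ 2 + n₂ ^ 2)) ^ 2 := by nlinarith [sq_nonneg n₁, sq_nonneg n₂, hpi, mul_nonneg hpi (sq_nonneg n₁), mul_nonneg hpi (sq_nonneg n₂)]
  have hrootM : Real.sqrt (∑ e : Edge 3 L, (2 * ℓG e + 2 * ℓF e) ^ 2) ≤ 6 * Real.pi * (n₁ ^ 2 + n₂ ^ 2) := by
    rw [← Real.sqrt_sq (show (0:ℝ) ≤ 6 * Real.pi * (n₁ ^ 2 + n₂ ^ 2) by positivity)]; exact Real.sqrt_le_sqrt hmix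
  have hcardU : ((((l₁.map Prod.fst).toFinset ∪ (l₂.map Prod.fst).toFinset).card : ℕ) : ℝ) ≤ n₁ + n₂ := by
    have h1 := Finset.card_union_le (l₁.map Prod.fst).toFinset (l₂.map Prod.fst).toFinset
    have h2 : ((((l₁.map Prod.fst).toFinset ∪ (l₂.map Prod.fst).toFinset).card : ℕ) : ℝ) ≤
        (((l₁.map Prod.fst).toFinset.card : ℕ) : ℝ) + (((l₂.map Prod.fst).toFinset.card : ℕ) : ℝ) := by exact_mod_cast h1
    linarith [hcard l₁, hcard l₂]
  have hAmp : ((((l₁.map Prod.fst).toFinset ∪ (l₂.map Prod.fst).toFinset).card : ℝ) * Real.sqrt (∑ e : Edge 3 L, (2 * ℓG e + 2 * ℓF e) ^ 2) +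
      2 * ((l₁.map Prod.fst).toFinset.card : ℝ) * Real.sqrt (∑ e : Edge 3 L, ℓF e ^ 2) + 2 * ((l₂.map Prod.fst).toFinset.card : ℝ) * Real.sqrt (∑ e : Edge 3 L, ℓG e ^ 2)) ≤
      10 * Real.pi * (n₁ + n₂) ^ 3 := by
    have a1 : (((l₁.map Prod.fst).toFinset ∪ (l₂.map Prod.fst).toFinset).card : ℝ) * Real.sqrt (∑ e : Edge 3 L, (2 * ℓG e + 2 * ℓF e) ^ 2) ≤
        (n₁ + n₂) * (6 * Real.pi * (n₁ ^ 2 + n₂ ^ 2)) := mul_le_mul hcardU hrootM (Real.sqrt_nonneg _) (by positivity)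
    have a2 : 2 * ((l₁.map Prod.fst).toFinset.card : ℝ) * Real.sqrt (∑ e : Edge 3 L, ℓF e ^ 2) ≤ 2 * n₁ * (2 * Real.pi * n₁ ^ 2) :=
      mul_le_mul (mul_le_mul_of_nonneg_left (hcard l₁) (by norm_num)) hrootF (Real.sqrt_nonneg _) (by positivity)
    have a3 : 2 * ((l₂.map Prod.fst).toFinset.card : ℝ) * Real.sqrt (∑ e : Edge 3 L, ℓG e ^ 2) ≤ 2 * n₂ * (2 * Real.pi * n₂ ^ 2) :=
      mul_le_mul (mul_le_mul_of_nonneg_left (hcard l₂) (by norm_num)) hrootG (Real.sqrt_nonneg _) (by positivity)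
    have a4 : (n₁ + n₂) * (6 * Real.pi * (n₁ ^ 2 + n₂ ^ 2)) + 2 * n₁ * (2 * Real.pi * n₁ ^ 2) + 2 * n₂ * (2 * Real.pi * n₂ ^ 2) ≤ 10 * Real.pi * (n₁ + n₂) ^ 3 := by
      nlinarith [mul_nonneg hn₁0 hn₂0, mul_nonneg (mul_nonneg hn₁0 hn₂0) hpi, mul_nonneg (mul_nonneg hn₁0 hn₂0) (mul_nonneg hpi hn₁0),
        mul_nonneg (mul_nonneg hn₁0 hn₂0) (mul_nonneg hpi hn₂0)]
    linarith [a1, a2, a3, a4]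
  have hlam0 : 0 ≤ (1300 + 4 * Real.sqrt 2) * |β'| := by positivity
  have hrho0 : 0 < 1 - 12 * |β'| := by linarith
  exact uniform_bound_le_of_words hlam0 hrho0 R (Finset.sum_nonneg fun e _ => hℓG0 e) hSF hSG hAmp

/-- ★★★ **Wilson loops ALONG EVERY SZZ SOLUTION from a deterministic start — e.g. the COLD START — uniformly in time** (`|β'| < 1/12`, any
filtered probability space, any flat Brownian driver, every volume): for loop words `w₁, w₂` at cyclic sup-distance `≥ R+1` and EVERY `t ≥ 0`,
`|E[Re tr w₁(U_t)·Re tr w₂(U_t)] − E[Re tr w₁(U_t)]·E[Re tr w₂(U_t)]| ≤ π²(384t⋆|w₁|²|w₂|² + 32|w₁|²|w₂|²(1+T_R) + 120(27(1+6(λ+ρ)/ρ)³+2)(|w₁|+|w₂|)³)·e^(−ρt⋆/2)`.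
Fixed cut-off; `UniformColdStartMixing` (24809) is NOT restated; the Yang–Mills mass gap is NOT proved. [folklore] -/
theorem wilson_loop_solution_covariance_abs_le_uniform (L : ℕ) [NeZero L] (β' : ℝ) (hβ : |β'| < 1 / 12) (t : ℝ≥0)
    (x₀ : (GaugeConfig 3 L (Matrix.specialUnitaryGroup (Fin 2) ℂ)))
    (Ω : Type) [MeasurableSpace Ω] (P : Measure Ω) [IsProbabilityMeasure P]
    (W : ℝ≥0 → Ω → (Edge 3 L × NoiseIdx 2 → ℝ)) (hW : IsFlatBrownian W P)
    (U : ℝ≥0 → Ω → (GaugeConfig 3 L (Matrix.specialUnitaryGroup (Fin 2) ℂ))) (hU0 : ∀ ω, U 0 ω = x₀)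
    (hU : (latticeLangevinDynamics (fundamentalLatticeRep 2) β').IsSolution (fundamentalRep (Fin 2)) hW.natFiltration P W U)
    (l₁ l₂ : List (Edge 3 L × Bool)) (R : ℕ)
    (hsep : ∀ e' ∈ (l₁.map Prod.fst).toFinset, ∀ e ∈ (l₂.map Prod.fst).toFinset, R + 1 ≤ (Finset.univ.sup fun i : Fin 3 => ((e'.1 i - e.1 i).valMinAbs).natAbs)) :
    let coords : GaugeConfig 3 L (Matrix.specialUnitaryGroup (Fin 2) ℂ) → (Edge 3 L × Fin 2 × Fin 2 × Bool → ℝ) :=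
      fun V q => (fun z : ℂ => if q.2.2.2 then z.im else z.re)
        ((fundamentalRep (Fin 2) (V q.1) : Matrix (Fin 2) (Fin 2) ℂ) q.2.1 q.2.2.1)
    |(∫ ω, (fun y : (Edge 3 L × Fin 2 × Fin 2 × Bool → ℝ) => ((l₁.map (fun a : Edge 3 L × Bool => if a.2 then ((fun (ee : Edge 3 L) => Matrix.of fun (i j : Fin 2) => ((y (ee, i, j, false) : ℝ) : ℂ) + ((y (ee, i, j, true) : ℝ) : ℂ) * Complex.I) a.1)ᴴ else (fun (ee : Edge 3 L) => Matrix.of fun (i j : Fin 2) => ((y (ee, i, j, false) : ℝ) : ℂ) + ((y (ee, i, j, true) : ℝ) : ℂ) * Complex.I) a.1)).prod).trace.re) (coords (U t ω)) * (fun y : (Edge 3 L × Fin 2 × Fin 2 × Bool → ℝ) => ((l₂.map (fun a : Edge 3 L × Bool => if a.2 then ((fun (ee : Edge 3 L) => Matrix.of fun (i j : Fin 2) => ((y (ee, i, j, false) : ℝ) : ℂ) + ((y (ee, i, j, true) : ℝ) : ℂ) * Complex.I) a.1)ᴴ else (fun (ee : Edge 3 L) => Matrix.of fun (i j : Fin 2)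 => ((y (ee, i, j, false) : ℝ) : ℂ) + ((y (ee, i, j, true) : ℝ) : ℂ) * Complex.I) a.1)).prod).trace.re) (coords (U t ω)) ∂P) -
        (∫ ω, (fun y : (Edge 3 L × Fin 2 × Fin 2 × Bool → ℝ) => ((l₁.map (fun a : Edge 3 L × Bool => if a.2 then ((fun (ee : Edge 3 L) => Matrix.of fun (i j : Fin 2) => ((y (ee, i, j, false) : ℝ) : ℂ) + ((y (ee, i, j, true) : ℝ) : ℂ) * Complex.I) a.1)ᴴ else (fun (ee : Edge 3 L) => Matrix.of fun (i j : Fin 2) => ((y (ee, i, j, false) : ℝ) : ℂ) + ((y (ee, i, j, true) : ℝ) : ℂ) * Complex.I) a.1)).prod).trace.re) (coords (U t ω)) ∂P) * (∫ ω, (fun y : (Edge 3 L × Fin 2 × Fin 2 × Bool → ℝ) => ((l₂.map (fun a : Edge 3 L × Bool => if a.2 then ((fun (ee : Edge 3 L) => Matrix.of fun (i j : Fin 2) => ((y (ee, i, j, false) : ℝ) : ℂ) + ((y (ee, i, j, true) : ℝ) : ℂ) * Complex.I) a.1)ᴴ else (fun (ee : Edge 3 L) => Matrix.of fun (i j : Fin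 2) => ((y (ee, i, j, false) : ℝ) : ℂ) + ((y (ee, i, j, true) : ℝ) : ℂ) * Complex.I) a.1)).prod).trace.re) (coords (U t ω)) ∂P)| ≤
      Real.pi ^ 2 * (384 * (((R : ℝ) + 1) * Real.log 2 / (2 * ((1300 + 4 * Real.sqrt 2) * |β'|) + (1 - 12 * |β'|))) * (l₁.length : ℝ) ^ 2 * (l₂.length : ℝ) ^ 2 + 32 * (l₁.length : ℝ) ^ 2 * (l₂.length : ℝ) ^ 2 * (1 + (((R : ℝ) + 1) * Real.log 108 / (((1300 + 4 * Real.sqrt 2) * |β'|) + (1 - 12 * |β'|)))) + 120 * (27 * (1 + 6 * (((1300 + 4 * Real.sqrt 2) * |β'|) + (1 - 12 * |β'|)) / (1 - 12 * |β'|)) ^ 3 + 2) * ((l₁.length : ℝ) + (l₂.length : ℝ)) ^ 3) * Real.exp (-((1 - 12 * |β'|) * (((R : ℝ) + 1) * Real.log 2 / (2 * (2 * ((1300 + 4 * Real.sqrt 2) * |β'|) + (1 - 12 * |β'|)))))) := by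
  intro coords
  classical
  haveI := secondCountableTopology_su2
  haveI := borelSpace_config L
  obtain ⟨κ, hκ, -, hreal⟩ := exists_transitionKernel L β'
  haveI := hκ
  have h := wilson_loop_transition_covariance_abs_le_uniform L β' hβ κ hreal l₁ l₂ R hsep t x₀
  have hlaw : κ t x₀ = P.map (U t) := hreal t x₀ Ω P W hW U hU0 hU
  have hmU : Measurable (U t) := (hU.adapted t).mono (hW.natFiltration.le t) le_rfl
  have hco : Continuous coords := continuous_coords (L := L)
  have hFm : Measurable fun y : (GaugeConfig 3 L (Matrix.specialUnitaryGroup (Fin 2) ℂ)) => (fun y : (Edge 3 L × Fin 2 × Fin 2 × Bool → ℝ) => ((l₁.map (fun a : Edge 3 L × Bool => if a.2 then ((fun (ee : Edge 3 L) => Matrix.of fun (i j : Fin 2) => ((y (ee, i, j, false) : ℝ) : ℂ) + ((y (ee, i, j, true) : ℝ) : ℂ) * Complex.I) a.1)ᴴ else (fun (ee : Edge 3 L) => Matrix.of fun (i j : Fin 2) => ((y (ee, i, j, false) : ℝ) : ℂ) + ((y (ee, i, j, true) : ℝ) : ℂ) * Complex.I) a.1)).prod).trace.re) (coords y) :=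
    ((contDiff_word (L := L) l₁ (m := 3)).continuous.comp hco).measurable
  have hGm : Measurable fun y : (GaugeConfig 3 L (Matrix.specialUnitaryGroup (Fin 2) ℂ)) => (fun y : (Edge 3 L × Fin 2 × Fin 2 × Bool → ℝ) => ((l₂.map (fun a : Edge 3 L × Bool => if a.2 then ((fun (ee : Edge 3 L) => Matrix.of fun (i j : Fin 2) => ((y (ee, i, j, false) : ℝ) : ℂ) + ((y (ee, i, j, true) : ℝ) : ℂ) * Complex.I) a.1)ᴴ else (fun (ee : Edge 3 L) => Matrix.of fun (i j : Fin 2) => ((y (ee, i, j, false) : ℝ) : ℂ) + ((y (ee, i, j, true) : ℝ) : ℂ) * Complex.I) a.1)).prod).trace.re) (coords y) :=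
    ((contDiff_word (L := L) l₂ (m := 3)).continuous.comp hco).measurable
  have hFGm : Measurable fun y : (GaugeConfig 3 L (Matrix.specialUnitaryGroup (Fin 2) ℂ)) => (fun y : (Edge 3 L × Fin 2 × Fin 2 × Bool → ℝ) => ((l₁.map (fun a : Edge 3 L × Bool => if a.2 then ((fun (ee : Edge 3 L) => Matrix.of fun (i j : Fin 2) => ((y (ee, i, j, false) : ℝ) : ℂ) + ((y (ee, i, j, true) : ℝ) : ℂ) * Complex.I) a.1)ᴴ else (fun (ee : Edge 3 L) => Matrix.of fun (i j : Fin 2) => ((y (ee, i, j, false) : ℝ) : ℂ) + ((y (ee, i, j, true) : ℝ) : ℂ) * Complex.I) a.1)).prod).trace.re) (coords y) * (fun y : (Edge 3 L × Fin 2 × Fin 2 × Bool → ℝ) => ((l₂.map (fun a : Edge 3 L × Bool => if a.2 then ((fun (ee : Edge 3 L) => Matrix.of fun (i j : Fin 2) => ((y (ee, i, j, false) : ℝ) : ℂ) + ((y (ee, i, j, true) : ℝ) : ℂ) * Complex.I) a.1)ᴴ else (fun (ee : Edge 3 L) => Matrix.of fun (i j : Fin 2) => ((y (ee, i, j, false)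 : ℝ) : ℂ) + ((y (ee, i, j, true) : ℝ) : ℂ) * Complex.I) a.1)).prod).trace.re) (coords y) := hFm.mul hGm
  have e1 : ∫ y, (fun y : (Edge 3 L × Fin 2 × Fin 2 × Bool → ℝ) => ((l₁.map (fun a : Edge 3 L × Bool => if a.2 then ((fun (ee : Edge 3 L) => Matrix.of fun (i j : Fin 2) => ((y (ee, i, j, false) : ℝ) : ℂ) + ((y (ee, i, j, true) : ℝ) : ℂ) * Complex.I) a.1)ᴴ else (fun (ee : Edge 3 L) => Matrix.of fun (i j : Fin 2) => ((y (ee, i, j, false) : ℝ) : ℂ) + ((y (ee, i, j, true) : ℝ) : ℂ) * Complex.I) a.1)).prod).trace.re) (coords y) * (fun y : (Edge 3 L × Fin 2 × Fin 2 × Bool → ℝ) => ((l₂.map (fun a : Edge 3 L × Bool => if a.2 then ((fun (ee : Edge 3 L) => Matrix.of fun (i j : Fin 2) => ((y (ee, i, j, false) : ℝ) : ℂ) + ((y (ee, i, j, true) : ℝ) : ℂ) * Complex.I) a.1)ᴴ else (fun (ee : Edge 3 L) => Matrix.of fun (i j : Fin 2) => ((y (ee, i, j, false) : ℝ) : ℂ)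 + ((y (ee, i, j, true) : ℝ) : ℂ) * Complex.I) a.1)).prod).trace.re) (coords y) ∂(κ t x₀) = ∫ ω, (fun y : (Edge 3 L × Fin 2 × Fin 2 × Bool → ℝ) => ((l₁.map (fun a : Edge 3 L × Bool => if a.2 then ((fun (ee : Edge 3 L) => Matrix.of fun (i j : Fin 2) => ((y (ee, i, j, false) : ℝ) : ℂ) + ((y (ee, i, j, true) : ℝ) : ℂ) * Complex.I) a.1)ᴴ else (fun (ee : Edge 3 L) => Matrix.of fun (i j : Fin 2) => ((y (ee, i, j, false) : ℝ) : ℂ) + ((y (ee, i, j, true) : ℝ) : ℂ) * Complex.I) a.1)).prod).trace.re) (coords (U t ω)) * (fun y : (Edge 3 L × Fin 2 × Fin 2 × Bool → ℝ) => ((l₂.map (fun a : Edge 3 L × Bool => if a.2 then ((fun (ee : Edge 3 L) => Matrix.of fun (i j : Fin 2) => ((y (ee, i, j, false) : ℝ) : ℂ) + ((y (ee, i, j, true) : ℝ) : ℂ) * Complex.I) a.1)ᴴ else (fun (ee : Edge 3 L) => Matrix.of fun (i j : Fin 2) => ((y (ee, i, j, false) : ℝ) : ℂ) + ((y (ee,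 i, j, true) : ℝ) : ℂ) * Complex.I) a.1)).prod).trace.re) (coords (U t ω)) ∂P := by
    rw [hlaw, integral_map hmU.aemeasurable hFGm.aestronglyMeasurable]
  have e2 : ∫ y, (fun y : (Edge 3 L × Fin 2 × Fin 2 × Bool → ℝ) => ((l₁.map (fun a : Edge 3 L × Bool => if a.2 then ((fun (ee : Edge 3 L) => Matrix.of fun (i j : Fin 2) => ((y (ee, i, j, false) : ℝ) : ℂ) + ((y (ee, i, j, true) : ℝ) : ℂ) * Complex.I) a.1)ᴴ else (fun (ee : Edge 3 L) => Matrix.of fun (i j : Fin 2) => ((y (ee, i, j, false) : ℝ) : ℂ) + ((y (ee, i, j, true) : ℝ) : ℂ) * Complex.I) a.1)).prod).trace.re) (coords y) ∂(κ t x₀) = ∫ ω, (fun y : (Edge 3 L × Fin 2 × Fin 2 × Bool → ℝ) => ((l₁.map (fun a : Edge 3 L × Bool => if a.2 then ((fun (ee : Edge 3 L) => Matrix.of fun (i j : Fin 2) => ((y (ee, i, j, false) : ℝ) : ℂ) + ((y (ee, i, j, true) : ℝ) : ℂ) * Complex.I) a.1)ᴴ else (fun (ee : Edge 3 L) => Matrix.of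 fun (i j : Fin 2) => ((y (ee, i, j, false) : ℝ) : ℂ) + ((y (ee, i, j, true) : ℝ) : ℂ) * Complex.I) a.1)).prod).trace.re) (coords (U t ω)) ∂P := by
    rw [hlaw, integral_map hmU.aemeasurable hFm.aestronglyMeasurable]
  have e3 : ∫ y, (fun y : (Edge 3 L × Fin 2 × Fin 2 × Bool → ℝ) => ((l₂.map (fun a : Edge 3 L × Bool => if a.2 then ((fun (ee : Edge 3 L) => Matrix.of fun (i j : Fin 2) => ((y (ee, i, j, false) : ℝ) : ℂ) + ((y (ee, i, j, true) : ℝ) : ℂ) * Complex.I) a.1)ᴴ else (fun (ee : Edge 3 L) => Matrix.of fun (i j : Fin 2) => ((y (ee, i, j, false) : ℝ) : ℂ) + ((y (ee, i, j, true) : ℝ) : ℂ) * Complex.I) a.1)).prod).trace.re) (coords y) ∂(κ t x₀) = ∫ ω, (fun y : (Edge 3 L × Fin 2 × Fin 2 × Bool → ℝ) => ((l₂.map (fun a : Edge 3 L × Bool => if a.2 then ((fun (ee : Edge 3 L) => Matrix.of fun (i j : Fin 2) => ((y (ee, i, j, false) : ℝ) : ℂ) + ((y (ee, i, j, true) : ℝ)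 : ℂ) * Complex.I) a.1)ᴴ else (fun (ee : Edge 3 L) => Matrix.of fun (i j : Fin 2) => ((y (ee, i, j, false) : ℝ) : ℂ) + ((y (ee, i, j, true) : ℝ) : ℂ) * Complex.I) a.1)).prod).trace.re) (coords (U t ω)) ∂P := by
    rw [hlaw, integral_map hmU.aemeasurable hGm.aestronglyMeasurable]
  rw [← e1, ← e2, ← e3]
  exact h

end Summit.QuantumFields.YangMills.Theorems.ColdStartUniversality.LiebRobinson

end
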